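import Mathlib
import HarnessLib
import Summits.Ventures.LatticeQCDFlow.Scaling.GeneralLayerWorkVariance
import Summits.Ventures.LatticeQCDFlow.Scaling.GeneralLayerESSCeiling
import Summits.Ventures.LatticeQCDFlow.Scaling.GeneralLayerESSFloorSharp

/-!
# GeneralLayerSwitchingLaws — reader's digest: the mean-work, work-variance and two-sided ESS laws
# of the uniform switching protocol for REVERSIBLE IRREDUCIBLE POSITIVE layers, under ONE hypothesis
# list (`λ⋆(P_k) ≤ ρ`, `θ = ρ·e^{ΔD/(2n)} < 1` resp. `θ₂ = ρ·e^{3ΔD/n} < 1`, `|D x − D y| ≤ ΔD`,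
# `Var_c(D) ≤ σ̄²`, `|κ₃| ≤ M₃`)

HONEST FRAMING: exact (Metropolis-corrected) sampling algorithms for lattice gauge theory;
figures of merit are autocorrelation/cost numbers at stated couplings and volumes; no
continuum-physics claim.

Venture `LatticeQCDFlow` (cell pub-lqcd), topic `Scaling`; FANOUT row 19 (`su2-snf`, GEN-5/6).
OUR WORK; no new mathematics — this file only INSTANTIATES
`Scaling/GeneralLayerLagLawUniform`, `Scaling/GeneralLayerWorkVariance`,
`Scaling/GeneralLayerESSCeiling` and `Scaling/GeneralLayerESSFloorSharp` at the layer class a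
practitioner meets (stochastic kernels with
positive entries in detailed balance with their target Gibbs law — heat-bath, Metropolis and their
palindromic sweeps — and irreducible), so that one import gives the three laws with the SAME
hypotheses.  Setting: finite configuration space, `S_c = S₀ + c•D`, grid `c_j = j/n`, layer `P k`
after the switch to `(k+1)/n`; `ρ` bounds every `λ⋆(P k)` (one minus the absolute spectral gap,
`1 − 1/t_rel`); `θ = ρ·e^{ΔD/(2n)}`, `θ₂ = ρ·e^{3ΔD/n}`; `σ̄² ≥ Var_c(D)`; `M₃ ≥ |κ₃,c(D)|` on `[0,1]`.

* `reversible_meanWork_law` — `|⟨W⟩ − ΔF − KL_qs| ≤ (θ/(1−θ))·σ̄²/n`, and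
  `reversible_meanWork_le_tauInt` — `⟨W⟩ − ΔF ≤ 2·τ̄·σ̄²/(2n) + M₃/(12n²)`, `τ̄ = tauInt(θ^t)`;
* `reversible_workVariance_law` — `Var W ≤ (1/n)(σ̄ + ε̄)(σ̄(1+θ)/(1−θ) + ε̄(1+√θ)/(1−√θ))`;
* `reversible_ess_ceiling` — `ÊSS ≤ exp(−[(⟨D⟩_0 − ⟨D⟩_1)/(2n) − (θ/(1−θ))σ̄²/n − M₃/(12n²)])`;
  `reversible_ess_floor` — `exp(−((1+θ₂)/(1−θ₂))·σ̄²/n) ≤ ÊSS` (`−log ÊSS ≤ 2τ̄(θ₂)σ̄²/n`);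
  `reversible_ess_two_sided` — both at once: the certified window for `−log ÊSS` at every `n`;
* `reversible_work_expMoment` — the MGF envelope of `Scaling/WorkExponentialMoments`:
  `E_F[e^{−t(W−ΔF)}] ≤ exp((½[t(t−1)]₊ + |t(t−1)|θ_t/(1−θ_t))σ̄²/n)`, `θ_t = ρe^{(5|t|+2|t−1|)ΔD/(4n)}`
  (sub-Gaussian work with the AR(1) variance proxy; Chernoff tails in that file);
  `reversible_acceptance_floor` — the stationary path-Metropolis (NCMC / SNF) acceptance is at least
  `(8/9)·exp(−((1+θ₂)/(1−θ₂))σ̄²/n)`; `reversible_ess_ge_one_sub_of_steps` — `n ≥ 6ΔD/(1−ρ)` and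
  `n ≥ 2(1+ρ)σ̄²/((1−ρ)ε)` give `ÊSS ≥ 1 − ε`;
* `reversible_endpoint_bias` — `|E_{μ_j}[O] − ⟨O⟩_{j/n}| ≤ (θ/(1−θ))(σ̄/n)·σ_{j/n}(O)`.

Dictionary (E7 = Bonanno et al., arXiv:2510.25704 §3.1; `Scaling/AR1SwitchingLaw` the solvable
model; NOT a theorem here): with Gaussian work `−log ESS = Var W = 2(⟨W⟩ − ΔF)`, the fitted
`k′ = 2τ_int·Δ²σ²` is the common leading constant of the first two laws and of the ESS floor —
all three are CERTIFIED UPPER ENVELOPES (on `⟨W⟩ − ΔF`, `Var W`, `−log ÊSS`) for every reversible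
layer family, with `τ_int` that of the SLOWEST mode; the floor's leading constant is attained by the
AR(1) model.  NOT CLAIMED: values of `ρ`, `σ̄`, `M₃` for any lattice kernel; tightness beyond that
(see the parents' notes).
-/

namespace Summit.Ventures.LatticeQCDFlow.Scaling

open Finset
open Literature.Probability.MarkovChains (IsRowStochastic DetailedBalance IsIrreducible lambdaStar
  lambdaStar_nonneg)
open Summit.Ventures.LatticeQCDFlow.Exactness
open Summit.Ventures.LatticeQCDFlow.Theory2

variable {X : Type*} [Fintype X] [Nonempty X] [DecidableEq X]

section Reversible

variable (S₀ D : X → ℝ) (P : ℕ → X → X → ℝ) {n : ℕ} {ΔD ρ σbar M₃ : ℝ}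

/-- The `χ²`-contraction of every layer from `λ⋆ ≤ ρ` (reversible, irreducible, stochastic). -/
theorem chiSqContracts_of_lambdaStar_le (hP : ∀ k, IsRowStochastic (P k))
    (hDB : ∀ k, DetailedBalance (gibbsLaw (linAction S₀ D (((k + 1 : ℕ) : ℝ) / n))) (P k))
    (hirr : ∀ k, IsIrreducible (P k)) (hlam : ∀ k, lambdaStar (P k) ≤ ρ) (k : ℕ) :
    ChiSqContracts (P k) (gibbsLaw (linAction S₀ D (((k + 1 : ℕ) : ℝ) / n))) ρ :=
  (chiSqContracts_of_reversible (gibbsLaw_pos _) (sum_gibbsLaw _) (hP k) (hDB k) (hirr k)).mono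
    (fun x => (gibbsLaw_pos _ x).le) (lambdaStar_nonneg _) (hlam k)

/-- **Mean-work law** (reversible layers): `|⟨W⟩ − ΔF − KL_qs| ≤ (θ/(1−θ))·σ̄²/n`. -/
theorem reversible_meanWork_law (hn : n ≠ 0) (hD : ∀ x y, |D x - D y| ≤ ΔD)
    (hP : ∀ k, IsRowStochastic (P k))
    (hDB : ∀ k, DetailedBalance (gibbsLaw (linAction S₀ D (((k + 1 : ℕ) : ℝ) / n))) (P k))
    (hirr : ∀ k, IsIrreducible (P k)) (hlam : ∀ k, lambdaStar (P k) ≤ ρ)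
    (hσ0 : 0 ≤ σbar) (hσ : ∀ c, varD S₀ D c ≤ σbar ^ 2)
    (hθ1 : ρ * Real.exp (ΔD / (2 * n)) < 1) :
    |layerDissipation S₀ D (fun k => (k : ℝ) / n) P n
        - qsDissipation S₀ D (fun k => (k : ℝ) / n) n|
      ≤ (ρ * Real.exp (ΔD / (2 * n))) / (1 - ρ * Real.exp (ΔD / (2 * n))) * (σbar ^ 2 / n) :=
  abs_layerDissipation_uniform_sub_qs_le_of_reversible S₀ D P hn hD hP hDB hirr hlam hσ0 hσ hθ1

/-- **Mean-work law, `τ_int` form** (reversible layers):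
`⟨W⟩ − ΔF ≤ 2·τ̄·σ̄²/(2n) + M₃/(12n²)`, `τ̄ = tauInt(θ^t) = (1+θ)/(2(1−θ))`. -/
theorem reversible_meanWork_le_tauInt (hn : n ≠ 0) (hD : ∀ x y, |D x - D y| ≤ ΔD)
    (hP : ∀ k, IsRowStochastic (P k))
    (hDB : ∀ k, DetailedBalance (gibbsLaw (linAction S₀ D (((k + 1 : ℕ) : ℝ) / n))) (P k))
    (hirr : ∀ k, IsIrreducible (P k)) (hlam : ∀ k, lambdaStar (P k) ≤ ρ)
    (hσ0 : 0 ≤ σbar) (hσ : ∀ c, varD S₀ D c ≤ σbar ^ 2)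
    (hθ1 : ρ * Real.exp (ΔD / (2 * n)) < 1)
    (hM : ∀ c ∈ Set.Icc (0:ℝ) 1, |kappa3D S₀ D c| ≤ M₃) :
    layerDissipation S₀ D (fun k => (k : ℝ) / n) P n
      ≤ 2 * Scoring.tauInt (fun t => (ρ * Real.exp (ΔD / (2 * n))) ^ t) * (σbar ^ 2 / (2 * n))
        + M₃ / (12 * (n : ℝ) ^ 2) :=
  layerDissipation_uniform_le_tauInt S₀ D P (fun k => (hP k).2) hn hD
    (chiSqContracts_of_lambdaStar_le S₀ D P hP hDB hirr hlam)
    ((lambdaStar_nonneg (P 0)).trans (hlam 0)) hσ0 hσ hθ1 hM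

/-- **Work-variance law** (reversible positive layers):
`Var_path(W) ≤ (1/n)(σ̄ + ε̄)(σ̄(1+θ)/(1−θ) + ε̄(1+√θ)/(1−√θ))`, `ε̄ = √((θ/(1−θ))(σ̄/n)ΔDσ̄)`. -/
theorem reversible_workVariance_law (hn : n ≠ 0) {θ εbar : ℝ} (hD : ∀ x y, |D x - D y| ≤ ΔD)
    (hP : ∀ k, IsRowStochastic (P k))
    (hDB : ∀ k, DetailedBalance (gibbsLaw (linAction S₀ D (((k + 1 : ℕ) : ℝ) / n))) (P k))
    (hirr : ∀ k, IsIrreducible (P k)) (hlam : ∀ k, lambdaStar (P k) ≤ ρ)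
    (hσ0 : 0 ≤ σbar) (hσ : ∀ c, varD S₀ D c ≤ σbar ^ 2)
    (hθ : θ = ρ * Real.exp (ΔD / (2 * n))) (hθ1 : θ < 1)
    (hε : εbar = Real.sqrt (θ / (1 - θ) * (σbar / n) * ΔD * σbar)) :
    layerWorkVar S₀ D (fun k => (k : ℝ) / n) P n
      ≤ (1 / n) * ((σbar + εbar)
          * (σbar * ((1 + θ) / (1 - θ)) + εbar * ((1 + Real.sqrt θ) / (1 - Real.sqrt θ)))) :=
  layerWorkVar_uniform_le_of_reversible S₀ D P hn hD hP hDB hirr hlam hσ0 hσ hθ hθ1 hε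

/-- **ESS ceiling** (reversible positive layers):
`ÊSS ≤ exp(−[(⟨D⟩_0 − ⟨D⟩_1)/(2n) − (θ/(1−θ))σ̄²/n − M₃/(12n²)])`. -/
theorem reversible_ess_ceiling (hn : n ≠ 0) (hD : ∀ x y, |D x - D y| ≤ ΔD)
    (hP : ∀ k, IsRowStochastic (P k)) (hPpos : ∀ k x y, 0 < P k x y)
    (hDB : ∀ k, DetailedBalance (gibbsLaw (linAction S₀ D (((k + 1 : ℕ) : ℝ) / n))) (P k))
    (hirr : ∀ k, IsIrreducible (P k)) (hlam : ∀ k, lambdaStar (P k) ≤ ρ)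
    (hσ0 : 0 ≤ σbar) (hσ : ∀ c, varD S₀ D c ≤ σbar ^ 2)
    (hθ1 : ρ * Real.exp (ΔD / (2 * n)) < 1)
    (hM : ∀ c ∈ Set.Icc (0:ℝ) 1, |kappa3D S₀ D c| ≤ M₃) :
    essFrac (revPathLaw (fun k : Fin (n + 1) => linAction S₀ D ((k : ℝ) / n)) (fun k : Fin n => P k))
        (pathLaw (gibbsLaw (linAction S₀ D (((0 : Fin (n + 1)) : ℝ) / n))) (fun k : Fin n => P k))
      ≤ Real.exp (-((meanD S₀ D 0 - meanD S₀ D 1) / (2 * n)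
          - (ρ * Real.exp (ΔD / (2 * n))) / (1 - ρ * Real.exp (ΔD / (2 * n))) * (σbar ^ 2 / n)
          - M₃ / (12 * (n : ℝ) ^ 2))) :=
  ess_path_uniform_le_exp_of_reversible S₀ D P hn hD hP hPpos hDB hirr hlam hσ0 hσ hθ1 hM

/-- **ESS floor** (reversible positive layers):
`exp(−((1+θ₂)/(1−θ₂))·σ̄²/n) ≤ ÊSS`, `θ₂ = ρ·e^{3ΔD/n}` (`−log ÊSS ≤ 2τ̄(θ₂)·σ̄²/n`). -/
theorem reversible_ess_floor (hn : n ≠ 0) (hD : ∀ x y, |D x - D y| ≤ ΔD)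
    (hP : ∀ k, IsRowStochastic (P k)) (hPpos : ∀ k x y, 0 < P k x y)
    (hDB : ∀ k, DetailedBalance (gibbsLaw (linAction S₀ D (((k + 1 : ℕ) : ℝ) / n))) (P k))
    (hirr : ∀ k, IsIrreducible (P k)) (hlam : ∀ k, lambdaStar (P k) ≤ ρ)
    (hσ0 : 0 ≤ σbar) (hσ : ∀ c, varD S₀ D c ≤ σbar ^ 2)
    (hθ2 : ρ * Real.exp (3 * ΔD / n) < 1) :
    Real.exp (-((1 + ρ * Real.exp (3 * ΔD / n)) / (1 - ρ * Real.exp (3 * ΔD / n))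
        * (σbar ^ 2 / n)))
      ≤ essFrac (revPathLaw (fun k : Fin (n + 1) => linAction S₀ D ((k : ℝ) / n))
            (fun k : Fin n => P k))
          (pathLaw (gibbsLaw (linAction S₀ D (((0 : Fin (n + 1)) : ℝ) / n))) (fun k : Fin n => P k)) :=
  exp_le_ess_path_uniform_sharp_of_reversible S₀ D P hn hD hP hPpos hDB hirr hlam hσ0 hσ hθ2

/-- **Two-sided ESS law** (reversible positive layers): the certified window
`exp(−((1+θ₂)/(1−θ₂))σ̄²/n) ≤ ÊSS ≤ exp(−[(⟨D⟩_0 − ⟨D⟩_1)/(2n) − (θ/(1−θ))σ̄²/n − M₃/(12n²)])`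
(`θ = ρe^{ΔD/(2n)} < 1` and `θ₂ = ρe^{3ΔD/n} < 1`). -/
theorem reversible_ess_two_sided (hn : n ≠ 0) (hD : ∀ x y, |D x - D y| ≤ ΔD)
    (hP : ∀ k, IsRowStochastic (P k)) (hPpos : ∀ k x y, 0 < P k x y)
    (hDB : ∀ k, DetailedBalance (gibbsLaw (linAction S₀ D (((k + 1 : ℕ) : ℝ) / n))) (P k))
    (hirr : ∀ k, IsIrreducible (P k)) (hlam : ∀ k, lambdaStar (P k) ≤ ρ)
    (hσ0 : 0 ≤ σbar) (hσ : ∀ c, varD S₀ D c ≤ σbar ^ 2)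
    (hθ1 : ρ * Real.exp (ΔD / (2 * n)) < 1) (hθ2 : ρ * Real.exp (3 * ΔD / n) < 1)
    (hM : ∀ c ∈ Set.Icc (0:ℝ) 1, |kappa3D S₀ D c| ≤ M₃) :
    Real.exp (-((1 + ρ * Real.exp (3 * ΔD / n)) / (1 - ρ * Real.exp (3 * ΔD / n))
        * (σbar ^ 2 / n)))
      ≤ essFrac (revPathLaw (fun k : Fin (n + 1) => linAction S₀ D ((k : ℝ) / n)) (fun k : Fin n => P k))
          (pathLaw (gibbsLaw (linAction S₀ D (((0 : Fin (n + 1)) : ℝ) / n))) (fun k : Fin n => P k))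
    ∧ essFrac (revPathLaw (fun k : Fin (n + 1) => linAction S₀ D ((k : ℝ) / n)) (fun k : Fin n => P k))
          (pathLaw (gibbsLaw (linAction S₀ D (((0 : Fin (n + 1)) : ℝ) / n))) (fun k : Fin n => P k))
      ≤ Real.exp (-((meanD S₀ D 0 - meanD S₀ D 1) / (2 * n)
          - (ρ * Real.exp (ΔD / (2 * n))) / (1 - ρ * Real.exp (ΔD / (2 * n))) * (σbar ^ 2 / n)
          - M₃ / (12 * (n : ℝ) ^ 2))) :=
  ⟨reversible_ess_floor S₀ D P hn hD hP hPpos hDB hirr hlam hσ0 hσ hθ2,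
    reversible_ess_ceiling S₀ D P hn hD hP hPpos hDB hirr hlam hσ0 hσ hθ1 hM⟩

/-- **Work MGF envelope** (reversible positive layers): for every real `t` with
`θ_t = ρ·e^{(5|t|+2|t−1|)ΔD/(4n)} < 1`,
`E_F[e^{−t(W−ΔF)}] ≤ exp((½[t(t−1)]₊ + |t(t−1)|·θ_t/(1−θ_t))·σ̄²/n)`. -/
theorem reversible_work_expMoment (t : ℝ) (hn : n ≠ 0) (hD : ∀ x y, |D x - D y| ≤ ΔD)
    (hP : ∀ k, IsRowStochastic (P k)) (hPpos : ∀ k x y, 0 < P k x y)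
    (hDB : ∀ k, DetailedBalance (gibbsLaw (linAction S₀ D (((k + 1 : ℕ) : ℝ) / n))) (P k))
    (hirr : ∀ k, IsIrreducible (P k)) (hlam : ∀ k, lambdaStar (P k) ≤ ρ)
    (hσ0 : 0 ≤ σbar) (hσ : ∀ c, varD S₀ D c ≤ σbar ^ 2)
    (hθt : ρ * Real.exp ((5 * |t| + 2 * |t - 1|) * ΔD / (4 * n)) < 1) :
    ∑ ω : Fin (n + 1) → X,
        pathLaw (gibbsLaw (linAction S₀ D (((0 : ℕ) : ℝ) / n))) (fun k : Fin n => P k) ω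
          * Real.exp (-(t * (work (fun k : Fin (n + 1) => linAction S₀ D ((k : ℝ) / n)) ω
              - (linFreeEnergy S₀ D 1 - linFreeEnergy S₀ D 0))))
      ≤ Real.exp ((max (t * (t - 1)) 0 / 2
          + |t * (t - 1)| * ((ρ * Real.exp ((5 * |t| + 2 * |t - 1|) * ΔD / (4 * n)))
              / (1 - ρ * Real.exp ((5 * |t| + 2 * |t - 1|) * ΔD / (4 * n)))))
          * (σbar ^ 2 / n)) :=
  expMoment_work_uniform_le_of_reversible t S₀ D P hn hD hP hPpos hDB hirr hlam hσ0 hσ hθt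

/-- **Acceptance floor** (reversible positive layers): the stationary Metropolis acceptance of the
non-equilibrium path proposal is at least `(8/9)·exp(−((1+θ₂)/(1−θ₂))·σ̄²/n)`. -/
theorem reversible_acceptance_floor (hn : n ≠ 0) (hD : ∀ x y, |D x - D y| ≤ ΔD)
    (hP : ∀ k, IsRowStochastic (P k)) (hPpos : ∀ k x y, 0 < P k x y)
    (hDB : ∀ k, DetailedBalance (gibbsLaw (linAction S₀ D (((k + 1 : ℕ) : ℝ) / n))) (P k))
    (hirr : ∀ k, IsIrreducible (P k)) (hlam : ∀ k, lambdaStar (P k) ≤ ρ)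
    (hσ0 : 0 ≤ σbar) (hσ : ∀ c, varD S₀ D c ≤ σbar ^ 2)
    (hθ2 : ρ * Real.exp (3 * ΔD / n) < 1) :
    8 / 9 * Real.exp (-((1 + ρ * Real.exp (3 * ΔD / n)) / (1 - ρ * Real.exp (3 * ΔD / n))
        * (σbar ^ 2 / n)))
      ≤ accRate (revPathLaw (fun k : Fin (n + 1) => linAction S₀ D ((k : ℝ) / n))
            (fun k : Fin n => P k))
          (pathLaw (gibbsLaw (linAction S₀ D (((0 : Fin (n + 1)) : ℝ) / n))) (fun k : Fin n => P k)) := by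
  have hρ : 0 ≤ ρ := (lambdaStar_nonneg (P 0)).trans (hlam 0)
  refine accRate_path_uniform_ge S₀ D P hn hD hPpos
    (fun k => isStationary_exp_of_detailedBalance_gibbsLaw (hDB k) (hP k).2)
    (fun k => (hP k).2) (chiSqContracts_of_lambdaStar_le S₀ D P hP hDB hirr hlam) hρ hσ0 hσ hθ2

/-- **Steps for `ÊSS ≥ 1 − ε`** (reversible positive layers, `ρ < 1`, `ε > 0`):
`n ≥ 6ΔD/(1−ρ)` and `n ≥ 2(1+ρ)σ̄²/((1−ρ)ε)` suffice. -/
theorem reversible_ess_ge_one_sub_of_steps (hn : n ≠ 0) {ε : ℝ} (hD : ∀ x y, |D x - D y| ≤ ΔD)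
    (hP : ∀ k, IsRowStochastic (P k)) (hPpos : ∀ k x y, 0 < P k x y)
    (hDB : ∀ k, DetailedBalance (gibbsLaw (linAction S₀ D (((k + 1 : ℕ) : ℝ) / n))) (P k))
    (hirr : ∀ k, IsIrreducible (P k)) (hlam : ∀ k, lambdaStar (P k) ≤ ρ) (hρ1 : ρ < 1)
    (hσ0 : 0 ≤ σbar) (hσ : ∀ c, varD S₀ D c ≤ σbar ^ 2) (hε : 0 < ε)
    (hn1 : 6 * ΔD / (1 - ρ) ≤ n) (hn2 : 2 * (1 + ρ) * σbar ^ 2 / ((1 - ρ) * ε) ≤ n) :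
    1 - ε ≤ essFrac (revPathLaw (fun k : Fin (n + 1) => linAction S₀ D ((k : ℝ) / n))
            (fun k : Fin n => P k))
          (pathLaw (gibbsLaw (linAction S₀ D (((0 : Fin (n + 1)) : ℝ) / n))) (fun k : Fin n => P k)) := by
  have hρ : 0 ≤ ρ := (lambdaStar_nonneg (P 0)).trans (hlam 0)
  exact ess_ge_one_sub_of_steps S₀ D P hn hD hPpos
    (fun k => isStationary_exp_of_detailedBalance_gibbsLaw (hDB k) (hP k).2)
    (fun k => (hP k).2) (chiSqContracts_of_lambdaStar_le S₀ D P hP hDB hirr hlam) hρ hρ1 hσ0 hσ hε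
    hn1 hn2

/-- **Endpoint / marginal bias** (reversible layers; the X-3 'weights dropped' reading): at every
step `j` and for every observable `O`,
`|E_{μ_j}[O] − ⟨O⟩_{j/n}| ≤ (θ/(1−θ))·(σ̄/n)·√Var_{j/n}(O)`. -/
theorem reversible_endpoint_bias (hn : n ≠ 0) (hD : ∀ x y, |D x - D y| ≤ ΔD)
    (hP : ∀ k, IsRowStochastic (P k))
    (hDB : ∀ k, DetailedBalance (gibbsLaw (linAction S₀ D (((k + 1 : ℕ) : ℝ) / n))) (P k))
    (hirr : ∀ k, IsIrreducible (P k)) (hlam : ∀ k, lambdaStar (P k) ≤ ρ)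
    (hσ0 : 0 ≤ σbar) (hσ : ∀ c, varD S₀ D c ≤ σbar ^ 2)
    (hθ1 : ρ * Real.exp (ΔD / (2 * n)) < 1) (O : X → ℝ) (j : ℕ) :
    |∑ y, evolveLaw P (gibbsLaw (linAction S₀ D 0)) j y * O y
        - gibbsMean (linAction S₀ D ((j : ℝ) / n)) O|
      ≤ (ρ * Real.exp (ΔD / (2 * n))) / (1 - ρ * Real.exp (ΔD / (2 * n))) * (σbar / n)
        * Real.sqrt (varLaw (gibbsLaw (linAction S₀ D ((j : ℝ) / n))) O) :=
  abs_marginal_mean_sub_gibbsMean_le S₀ D P (fun k => (hP k).2) hn hD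
    (chiSqContracts_of_lambdaStar_le S₀ D P hP hDB hirr hlam)
    ((lambdaStar_nonneg (P 0)).trans (hlam 0)) hσ0 hσ hθ1 O j

end Reversible

end Summit.Ventures.LatticeQCDFlow.Scaling
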